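import Literature.Probability.Percolation.PercolationProofs

/-!
# `CriticalCurveRegular` (crux stmt-CriticalPhenomena-16065, route `PercExchangeRateTransport`):
# the right endpoint `t = 1` of the parameter interval is load-bearing

Negative / tightness lemmas from the crux disprover (nothing here asserts the crux).

For the label-coupled anisotropic bond family on `ℤ²×ℤ` (x/y-bonds open iff `U_e ≤ p`, z-bonds iff
`U_e ≤ t`, `U` i.i.d. uniform under `labelMeasure (Site 3)`), at vertical density `t ≥ 1` the whole
column `{k e₃ : k ∈ ℕ}` through the origin is open almost surely (each label exceeds `1` with
probability `0`), so the origin percolates with probability `1` for EVERY real horizontal density `p`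
(`theta_eq_one_of_one_le`), and the anisotropic critical value
`p_c(t) = sInf ({p ∈ [0,1] | θ(p,t) > 0} ∪ {1})` is `0` (`pc_eq_zero_of_one_le`). Consequences recorded
for provers / planners of the crux `ContinuousOn p_c (0,1) ∧ ∀ t ∈ (0,1), 0 < p_c(t) < 1`:

* any proof of the bounds clause must USE the side condition `t < 1`
  (`criticalCurveRegular_false_without_openRight`);
* the natural strengthening of the bounds clause to the closed interval `t ∈ [0,1]` is FALSE
  (`criticalCurveRegular_false_on_Icc`), the obstruction sitting at `t = 1` only (at `t ≤ 0` the model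
  is a stack of independent planes and `p_c = p_c(ℤ²) ∈ (0,1)`);
* the lower bound `0 < p_c(t)` cannot be uniform on `(0,1)`: `p_c ≡ 0` on `[1,∞)` (consistent with the
  line's `p_c(t) ≥ (1-t)/8`).
-/

namespace Summit.CriticalPhenomena.PercolationContinuityZ3.Theorems.CriticalCurveRegular.Negative

open MeasureTheory Set Literature.Probability.Percolation Literature.Probability.LatticeModels

/-- One label exceeds `1` with probability `0` (the factor law is `Leb|[0,1]`). [folklore] -/
theorem measure_label_gt_one (e : Sym2 (Site 3)) :
    labelMeasure (Site 3) {U | 1 < U e} = 0 := by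
  have : IsProbabilityMeasure ((volume : Measure ℝ).restrict (Set.Icc (0 : ℝ) 1)) :=
    isProbabilityMeasure_volume_restrict_unitInterval
  have hmap := Measure.infinitePi_map_eval (fun _ : Sym2 (Site 3) =>
    (volume : Measure ℝ).restrict (Set.Icc (0 : ℝ) 1)) e
  have h1 : labelMeasure (Site 3) {U | 1 < U e} =
      ((labelMeasure (Site 3)).map fun U : Sym2 (Site 3) → ℝ => U e) (Set.Ioi 1) := by
    rw [Measure.map_apply (measurable_pi_apply e) measurableSet_Ioi]; rfl
  have h2 : Set.Ioi (1 : ℝ) ∩ Set.Icc 0 1 = ∅ := by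
    ext u
    simp only [Set.mem_inter_iff, Set.mem_Ioi, Set.mem_Icc, Set.mem_empty_iff_false, iff_false,
      not_and, not_le]
    intro hu _
    exact hu
  rw [h1, show labelMeasure (Site 3) = Measure.infinitePi (fun _ : Sym2 (Site 3) =>
    (volume : Measure ℝ).restrict (Set.Icc (0 : ℝ) 1)) from rfl, hmap,
    Measure.restrict_apply measurableSet_Ioi, h2, measure_empty]

/-- The column bonds `{k e₃, (k+1) e₃}`, `k : ℕ`, all carry a label `≤ 1` almost surely. [folklore] -/
theorem measure_column_labels_le_one :
    labelMeasure (Site 3) {U | ∀ k : ℕ,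
      U s(Pi.single (2 : Fin 3) (k : ℤ), Pi.single (2 : Fin 3) (k : ℤ) + Pi.single (2 : Fin 3) 1)
        ≤ 1} = 1 := by
  have hP := isProbabilityMeasure_labelMeasure (Site 3)
  have hmeas : MeasurableSet {U : Sym2 (Site 3) → ℝ | ∀ k : ℕ,
      U s(Pi.single (2 : Fin 3) (k : ℤ), Pi.single (2 : Fin 3) (k : ℤ) + Pi.single (2 : Fin 3) 1)
        ≤ 1} := by
    have : {U : Sym2 (Site 3) → ℝ | ∀ k : ℕ,
        U s(Pi.single (2 : Fin 3) (k : ℤ), Pi.single (2 : Fin 3) (k : ℤ) + Pi.single (2 : Fin 3) 1)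
          ≤ 1} = ⋂ k : ℕ, {U : Sym2 (Site 3) → ℝ |
        U s(Pi.single (2 : Fin 3) (k : ℤ), Pi.single (2 : Fin 3) (k : ℤ) + Pi.single (2 : Fin 3) 1)
          ≤ 1} := by
      ext U; simp
    rw [this]
    exact MeasurableSet.iInter fun k => measurableSet_le (measurable_pi_apply _) measurable_const
  refine (prob_compl_eq_zero_iff hmeas).1 (measure_mono_null ?_
    ((measure_iUnion_null_iff (ι := ℕ)).2 fun k => measure_label_gt_one
      s(Pi.single (2 : Fin 3) (k : ℤ), Pi.single (2 : Fin 3) (k : ℤ) + Pi.single (2 : Fin 3) 1)))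
  intro U hU
  simp only [Set.mem_compl_iff, Set.mem_setOf_eq, not_forall, not_le] at hU
  obtain ⟨k, hk⟩ := hU
  exact Set.mem_iUnion.2 ⟨k, hk⟩

/-- If all column bonds are open, every column site `k e₃` is joined to `0`. [folklore] -/
theorem column_reachable {ω : Set (Sym2 (Site 3))}
    (hω : ∀ k : ℕ,
      s(Pi.single (2 : Fin 3) (k : ℤ), Pi.single (2 : Fin 3) (k : ℤ) + Pi.single (2 : Fin 3) 1) ∈ ω)
    (k : ℕ) : (openGraph ω).Reachable 0 (Pi.single (2 : Fin 3) (k : ℤ)) := by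
  induction k with
  | zero => simp
  | succ k ih =>
    refine ih.trans (SimpleGraph.Adj.reachable ?_)
    have hk : (Pi.single (2 : Fin 3) ((k + 1 : ℕ) : ℤ) : Site 3) =
        Pi.single (2 : Fin 3) (k : ℤ) + Pi.single (2 : Fin 3) 1 := by
      rw [← Pi.single_add, Nat.cast_add, Nat.cast_one]
    rw [openGraph_adj, hk]
    refine ⟨hω k, fun h => ?_⟩
    have h2 := congrFun h 2
    simp only [Pi.add_apply, Pi.single_eq_same] at h2
    omega

/-- If all column bonds are open, the origin percolates. [folklore] -/
theorem percolatesAt_of_column {ω : Set (Sym2 (Site 3))}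
    (hω : ∀ k : ℕ,
      s(Pi.single (2 : Fin 3) (k : ℤ), Pi.single (2 : Fin 3) (k : ℤ) + Pi.single (2 : Fin 3) 1) ∈ ω) :
    ω ∈ percolatesAt (0 : Site 3) := by
  show (openCluster ω 0).Infinite
  have hinj : Function.Injective fun k : ℕ => (Pi.single (2 : Fin 3) (k : ℤ) : Site 3) := by
    intro a b h
    have h2 := congrFun h 2
    simp only [Pi.single_eq_same, Nat.cast_inj] at h2
    exact h2
  refine (Set.infinite_range_of_injective hinj).mono ?_
  rintro _ ⟨k, rfl⟩
  exact column_reachable hω k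

/-- At vertical density `t`, a column bond with label `≤ t` is open in the crux's configuration
`cfg p t U` (it is a vertical lattice bond). [folklore] -/
theorem column_mem_cfg {p t : ℝ} {U : Sym2 (Site 3) → ℝ} {k : ℕ}
    (h : U s(Pi.single (2 : Fin 3) (k : ℤ), Pi.single (2 : Fin 3) (k : ℤ) + Pi.single (2 : Fin 3) 1)
      ≤ t) :
    s(Pi.single (2 : Fin 3) (k : ℤ), Pi.single (2 : Fin 3) (k : ℤ) + Pi.single (2 : Fin 3) 1) ∈
      {e | e ∈ (zdGraph 3).edgeSet ∧
        (((∃ x : Site 3, e = s(x, x + Pi.single (2 : Fin 3) 1)) ∧ U e ≤ t) ∨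
          (¬ (∃ x : Site 3, e = s(x, x + Pi.single (2 : Fin 3) 1)) ∧ U e ≤ p))} := by
  rw [Set.mem_setOf_eq]
  exact ⟨(SimpleGraph.mem_edgeSet _).2 ((zdGraph_adj_iff _ _).2 ⟨2, Or.inl rfl⟩),
    Or.inl ⟨⟨_, rfl⟩, h⟩⟩

/-- **For `t ≥ 1` the origin percolates almost surely, for every real `p`** (the crux's `θ(p,t)`,
written with its own `vert`/`cfg`). [folklore] -/
theorem theta_eq_one_of_one_le (p : ℝ) {t : ℝ} (ht : 1 ≤ t) :
    (labelMeasure (Site 3)).real {U | {e | e ∈ (zdGraph 3).edgeSet ∧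
      (((∃ x : Site 3, e = s(x, x + Pi.single (2 : Fin 3) 1)) ∧ U e ≤ t) ∨
        (¬ (∃ x : Site 3, e = s(x, x + Pi.single (2 : Fin 3) 1)) ∧ U e ≤ p))} ∈
      percolatesAt (0 : Site 3)} = 1 := by
  have hP := isProbabilityMeasure_labelMeasure (Site 3)
  apply le_antisymm measureReal_le_one
  calc (1 : ℝ) = (labelMeasure (Site 3)).real {U | ∀ k : ℕ,
        U s(Pi.single (2 : Fin 3) (k : ℤ), Pi.single (2 : Fin 3) (k : ℤ) + Pi.single (2 : Fin 3) 1)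
          ≤ 1} := by
        rw [measureReal_def, measure_column_labels_le_one, ENNReal.toReal_one]
    _ ≤ _ := measureReal_mono (fun U hU => percolatesAt_of_column fun k =>
        column_mem_cfg ((hU k).trans ht)) (measure_ne_top _ _)

/-- **`p_c(t) = 0` for every `t ≥ 1`** (the crux's `pc`, written out). [folklore] -/
theorem pc_eq_zero_of_one_le {t : ℝ} (ht : 1 ≤ t) :
    sInf ({p : ℝ | 0 ≤ p ∧ p ≤ 1 ∧ 0 < (labelMeasure (Site 3)).real {U |
      {e | e ∈ (zdGraph 3).edgeSet ∧
        (((∃ x : Site 3, e = s(x, x + Pi.single (2 : Fin 3) 1)) ∧ U e ≤ t) ∨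
          (¬ (∃ x : Site 3, e = s(x, x + Pi.single (2 : Fin 3) 1)) ∧ U e ≤ p))} ∈
      percolatesAt (0 : Site 3)}} ∪ {1}) = 0 := by
  have h0 : (0 : ℝ) ∈ {p : ℝ | 0 ≤ p ∧ p ≤ 1 ∧ 0 < (labelMeasure (Site 3)).real {U |
      {e | e ∈ (zdGraph 3).edgeSet ∧
        (((∃ x : Site 3, e = s(x, x + Pi.single (2 : Fin 3) 1)) ∧ U e ≤ t) ∨
          (¬ (∃ x : Site 3, e = s(x, x + Pi.single (2 : Fin 3) 1)) ∧ U e ≤ p))} ∈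
      percolatesAt (0 : Site 3)}} ∪ {1} :=
    Or.inl ⟨le_rfl, zero_le_one, by rw [theta_eq_one_of_one_le 0 ht]; exact one_pos⟩
  have hlb : ∀ p ∈ {p : ℝ | 0 ≤ p ∧ p ≤ 1 ∧ 0 < (labelMeasure (Site 3)).real {U |
      {e | e ∈ (zdGraph 3).edgeSet ∧
        (((∃ x : Site 3, e = s(x, x + Pi.single (2 : Fin 3) 1)) ∧ U e ≤ t) ∨
          (¬ (∃ x : Site 3, e = s(x, x + Pi.single (2 : Fin 3) 1)) ∧ U e ≤ p))} ∈
      percolatesAt (0 : Site 3)}} ∪ {1}, (0 : ℝ) ≤ p := by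
    rintro p (⟨hp, -⟩ | hp)
    · exact hp
    · rw [Set.mem_singleton_iff] at hp; rw [hp]; exact zero_le_one
  exact le_antisymm (csInf_le ⟨0, hlb⟩ h0) (le_csInf ⟨0, h0⟩ hlb)

/-- **Any proof of the crux must use `t < 1`.** The crux with the side condition `t < 1` dropped
from its bounds clause (same `let`-prefix as the route item) is FALSE: `p_c(1) = 0`. [folklore] -/
theorem criticalCurveRegular_false_without_openRight :
    ¬ (let μ := Literature.Probability.Percolation.labelMeasure (Literature.Probability.LatticeModels.Site 3)
       let vert : Sym2 (Literature.Probability.LatticeModels.Site 3) → Prop :=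
         fun e => ∃ x : Literature.Probability.LatticeModels.Site 3, e = s(x, x + Pi.single (2 : Fin 3) 1)
       let cfg : ℝ → ℝ → (Sym2 (Literature.Probability.LatticeModels.Site 3) → ℝ) →
           Set (Sym2 (Literature.Probability.LatticeModels.Site 3)) :=
         fun p t U => {e | e ∈ (Literature.Probability.LatticeModels.zdGraph 3).edgeSet ∧
           ((vert e ∧ U e ≤ t) ∨ (¬ vert e ∧ U e ≤ p))}
       let θ : ℝ → ℝ → ℝ := fun p t => μ.real {U | cfg p t U ∈
         Literature.Probability.Percolation.percolatesAt (0 : Literature.Probability.LatticeModels.Site 3)}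
       let pc : ℝ → ℝ := fun t => sInf ({p : ℝ | 0 ≤ p ∧ p ≤ 1 ∧ 0 < θ p t} ∪ {1})
       ContinuousOn pc (Set.Ioo 0 1) ∧ ∀ t : ℝ, 0 < t → 0 < pc t ∧ pc t < 1) := by
  intro h
  have h1 := (h.2 1 one_pos).1
  dsimp only at h1
  rw [pc_eq_zero_of_one_le le_rfl] at h1
  exact lt_irrefl _ h1

/-- **The closed-interval strengthening of the bounds clause is false** (`p_c(1) = 0`; the left
endpoint is harmless, the right one is not). [folklore] -/
theorem criticalCurveRegular_false_on_Icc :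
    ¬ (let μ := Literature.Probability.Percolation.labelMeasure (Literature.Probability.LatticeModels.Site 3)
       let vert : Sym2 (Literature.Probability.LatticeModels.Site 3) → Prop :=
         fun e => ∃ x : Literature.Probability.LatticeModels.Site 3, e = s(x, x + Pi.single (2 : Fin 3) 1)
       let cfg : ℝ → ℝ → (Sym2 (Literature.Probability.LatticeModels.Site 3) → ℝ) →
           Set (Sym2 (Literature.Probability.LatticeModels.Site 3)) :=
         fun p t U => {e | e ∈ (Literature.Probability.LatticeModels.zdGraph 3).edgeSet ∧
           ((vert e ∧ U e ≤ t) ∨ (¬ vert e ∧ U e ≤ p))}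
       let θ : ℝ → ℝ → ℝ := fun p t => μ.real {U | cfg p t U ∈
         Literature.Probability.Percolation.percolatesAt (0 : Literature.Probability.LatticeModels.Site 3)}
       let pc : ℝ → ℝ := fun t => sInf ({p : ℝ | 0 ≤ p ∧ p ≤ 1 ∧ 0 < θ p t} ∪ {1})
       ContinuousOn pc (Set.Ioo 0 1) ∧ ∀ t ∈ Set.Icc (0 : ℝ) 1, 0 < pc t ∧ pc t < 1) := by
  intro h
  have h1 := (h.2 1 ⟨zero_le_one, le_rfl⟩).1
  dsimp only at h1
  rw [pc_eq_zero_of_one_le le_rfl] at h1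
  exact lt_irrefl _ h1

end Summit.CriticalPhenomena.PercolationContinuityZ3.Theorems.CriticalCurveRegular.Negative
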